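import Literature.Algebra.Homology.OrderedCechPairSystemShuffle
import Literature.Algebra.Homology.OrderedCechShuffleCoefficientIdentity
import Literature.Algebra.Homology.OrderedCechPairSystemBounds
import HarnessLib

/-!
# The shuffle map `∇ : Č(lexSystem P) ⟶ Tot Č•,•(P)` is a morphism of complexes (Eilenberg–Mac Lane 1953, Thm. 5.2, dualised;
# The Stacks Project, Tag 0BEC)

Layer `Literature/Algebra/Homology`, PROOF lane (theorems only; no definition, no instance, no notation, no named fact).  For a
pair-system `P : Finset ι ⥤ Finset κ ⥤ ModuleCat A` the components `shuffleComponent P n a b : Čⁿ(lexSystem P) →ₗ Čᵃᵇ(P)`,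
`(∇c)(τ)(σ) = Σ_{T ⊆ σ × τ} m(σ,τ,T) · c_T|` (`Algebra/Homology/OrderedCechPairSystemShuffle`), satisfy the compatibility
**`shuffleComponent_comm`**: `d ≫ ∇_{a',b'} = ∇_{a,b'} ≫ d₁ + (-1)^{a'} ∇_{a',b} ≫ d₂` (`a' = a + 1`, `b' = b + 1`; Mathlib's total sign),
i.e. exactly the hypothesis of the constructor `totalLift`; hence **`shuffleHom_comm`** — the shuffle map
`totalLift (sysBicomplex P) (sysComplex (lexSystem P)) … (fun n a b => ofHom (shuffleComponent P n a b)) …` IS a morphism of cochain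
complexes `Č(lexSystem P) ⟶ Tot Č•,•(P)` (packaged as the theorem that its hypotheses are met: `isZero` bounds + `shuffleComponent_comm`).
The combinatorial heart is the coefficient identity `sum_shuffleCoeff_insert_mul_sign` of `Algebra/Homology/OrderedCechShuffleCoefficientIdentity`;
this file supplies the three evaluations (§2) `∇(dc)`, `d₁(∇c)`, `d₂(∇c)` at `(τ, σ)` as sums `Σ_R (coefficient) • c_R|` over `R ⊆ σ × τ`
and compares coefficients (§3).

Cell `hodgecm-mathlib` (D-0151), F-11 / J3 Künneth packet, brick (K2-c-2) of F0P1b-p04's plan (RULINGS #3 (R15), #4 (R20)).  HC_CM is proved only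
modulo the 7 printed citations until rung 0 closes — nothing here bears on a summit statement.

## References
* S. Eilenberg, S. Mac Lane, *On the groups `H(Π,n)`, I*, Ann. of Math. 58 (1953), §5, Thm. 5.2. [EilenbergMacLane1953]
* The Stacks Project, Tag 0BEC, Tag 012K, Tag 01FG. [StacksProject]
* U. Görtz, T. Wedhorn, *Algebraic Geometry II* (2023), Def. 21.64, Def. 21.68 (pp. 179–180). [GortzWedhorn2023]
-/

universe u

open CategoryTheory CategoryTheory.Limits HomologicalComplex

set_option backward.isDefEq.respectTransparency false

noncomputable section

namespace Literature.Algebra.Homology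

namespace OrderedCech

variable {A : Type u} [CommRing A] {ι κ : Type} [LinearOrder ι] [LinearOrder κ]
  (P : Finset ι ⥤ Finset κ ⥤ ModuleCat.{u} A)

/-! ### §1 Small tools: casting the signs, evaluating cochains, re-indexing a double sum -/

omit [LinearOrder κ] in
/-- The integer Čech sign cast to `A` is the Čech sign in `A`. [cite: GortzWedhorn2023, Def. 21.68 (p. 180)] -/
theorem intCast_sign (s : Finset ι) (i : ι) : ((sign ℤ s i : ℤ) : A) = sign A s i := by
  unfold sign
  push_cast
  rfl

section Eval

variable {ι' : Type} [LinearOrder ι'] {M : Finset ι' ⥤ ModuleCat.{u} A} {n : ℤ}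

omit [LinearOrder ι] [LinearOrder κ] in
/-- Evaluation of a sum of cochains. [folklore] -/
private theorem SysCochain.sum_apply {β : Type*} (s : Finset β) (f : β → SysCochain M n) (σ : Simplex ι' n) :
    (∑ x ∈ s, f x) σ = ∑ x ∈ s, f x σ := by
  classical
  induction s using Finset.induction_on with
  | empty => rfl
  | insert x s hx ih => rw [Finset.sum_insert hx, Finset.sum_insert hx, ← ih]; rfl

omit [LinearOrder ι] [LinearOrder κ] in
/-- Evaluation of a scalar multiple of a cochain. [folklore] -/
private theorem SysCochain.smul_apply (r : A) (f : SysCochain M n) (σ : Simplex ι' n) : (r • f) σ = r • f σ := rfl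

end Eval

omit [LinearOrder ι] [LinearOrder κ] in
/-- Re-indexing `Σ_{T ⊆ B} Σ_{w ∈ T} g T w = Σ_{R ⊆ B} Σ_{w ∈ B ∖ R} g (R ∪ w) w` (`T = R ∪ w`, `R = T ∖ w`). [folklore] -/
private theorem sum_powerset_sum_mem_eq {α : Type*} [DecidableEq α] {M : Type*} [AddCommMonoid M] (B : Finset α)
    (g : Finset α → α → M) :
    ∑ T ∈ B.powerset, ∑ w ∈ T, g T w = ∑ R ∈ B.powerset, ∑ w ∈ B \ R, g (insert w R) w := by
  rw [Finset.sum_sigma', Finset.sum_sigma']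
  refine Finset.sum_bij' (fun x _ => (⟨x.1.erase x.2, x.2⟩ : Σ _ : Finset α, α))
    (fun y _ => (⟨insert y.2 y.1, y.2⟩ : Σ _ : Finset α, α)) ?_ ?_ ?_ ?_ ?_
  · rintro ⟨T, w⟩ hx
    simp only [Finset.mem_sigma, Finset.mem_powerset] at hx ⊢
    exact ⟨(Finset.erase_subset w T).trans hx.1,
      Finset.mem_sdiff.mpr ⟨hx.1 hx.2, Finset.notMem_erase w T⟩⟩
  · rintro ⟨R, w⟩ hy
    simp only [Finset.mem_sigma, Finset.mem_powerset, Finset.mem_sdiff] at hy ⊢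
    exact ⟨Finset.insert_subset hy.2.1 hy.1, Finset.mem_insert_self w R⟩
  · rintro ⟨T, w⟩ hx
    simp only [Finset.mem_sigma] at hx
    simp only [Finset.insert_erase hx.2]
  · rintro ⟨R, w⟩ hy
    simp only [Finset.mem_sigma, Finset.mem_sdiff] at hy
    simp only [Finset.erase_insert hy.2.2]
  · rintro ⟨T, w⟩ hx
    simp only [Finset.mem_sigma] at hx
    simp only [Finset.insert_erase hx.2]

/-! ### §2 The three evaluations -/

variable {P}

/-- **`(dc)` read in a rectangle**: for `T` with `π₁T ⊆ s`, `π₂T ⊆ t` (and `n ≥ 0`),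
`(dc).boxEval s t T = Σ_{w ∈ T} ε(T,w) • c.boxEval s t (T ∖ w)`. [cite: GortzWedhorn2023, Def. 21.68 (p. 180)] [cite: StacksProject, Tag 0BEC] -/
theorem SysCochain.boxEval_sysD {n : ℤ} (hn : 0 ≤ n) (c : SysCochain (lexSystem P) n) (s : Finset ι) (t : Finset κ)
    {T : Finset (ι ×ₗ κ)} (hT : fstProj T ⊆ s ∧ sndProj T ⊆ t) :
    (sysD (lexSystem P) n c).boxEval s t T = ∑ w ∈ T, sign A T w • c.boxEval s t (T.erase w) := by
  by_cases h2 : 2 ≤ T.card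
  · rw [SysCochain.boxEval_eq_pairRestrict_ext0At,
      ext0At_sysD (lexSystem P) n c T _ (subset_image_toLex_iff.mpr hT) h2, map_sum]
    refine Finset.sum_congr rfl fun w _ => ?_
    rw [map_smul, SysCochain.boxEval_eq_pairRestrict_ext0At]
  · rw [SysCochain.boxEval_eq_zero]
    swap
    · rintro ⟨⟨-, hc⟩, -⟩; omega
    symm
    refine Finset.sum_eq_zero fun w hw => ?_
    rw [SysCochain.boxEval_eq_zero, smul_zero]
    rintro ⟨⟨hne, hc⟩, -⟩
    have := Finset.card_erase_of_mem hw
    have := hne.card_pos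
    omega

/-- **`∇(dc)` at `(τ, σ)`** (`n ≥ 0`): `Σ_{R ⊆ σ × τ} (Σ_{w ∈ σ × τ ∖ R} m(σ,τ,R ∪ w) ε(R ∪ w, w)) • c.boxEval σ τ R`.
[cite: EilenbergMacLane1953, §5 (Thm. 5.2)] [cite: StacksProject, Tag 0BEC] -/
theorem shuffleComponent_sysD_apply {n : ℤ} (hn : 0 ≤ n) (a b : ℤ) (c : SysCochain (lexSystem P) n) (τ : Simplex κ b)
    (σ : Simplex ι a) :
    shuffleComponent P (n + 1) a b (sysD (lexSystem P) n c) τ σ =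
      ∑ R ∈ ((σ.1 ×ˢ τ.1).image toLex).powerset,
        (∑ w ∈ (σ.1 ×ˢ τ.1).image toLex \ R, (shuffleCoeff σ.1 τ.1 (insert w R) : A) * sign A (insert w R) w) •
          c.boxEval σ.1 τ.1 R := by
  rw [shuffleComponent_apply,
    Finset.sum_congr rfl fun T hT => by
      rw [SysCochain.boxEval_sysD hn c _ _ (subset_image_toLex_iff.mp (Finset.mem_powerset.mp hT)), Finset.smul_sum]]
  simp only [smul_smul]
  rw [sum_powerset_sum_mem_eq ((σ.1 ×ˢ τ.1).image toLex)
    (fun T w => ((shuffleCoeff σ.1 τ.1 T : A) * sign A T w) • c.boxEval σ.1 τ.1 (T.erase w))]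
  refine Finset.sum_congr rfl fun R _ => ?_
  rw [Finset.sum_smul]
  refine Finset.sum_congr rfl fun w hw => ?_
  rw [Finset.erase_insert (Finset.mem_sdiff.mp hw).2]

/-- Vanishing of a shuffle coefficient outside its rectangle, in the `powerset` form used below. [cite: EilenbergMacLane1953, §5] -/
theorem shuffleCoeff_eq_zero_of_not_mem_powerset {s : Finset ι} {t : Finset κ} {T : Finset (ι ×ₗ κ)}
    (h : T ∉ ((s ×ˢ t).image toLex).powerset) : shuffleCoeff s t T = 0 := by
  by_contra hne
  exact h (Finset.mem_powerset.mpr fun w hw => mem_image_toLex.mpr (mem_of_shuffleCoeff_ne_zero hne hw))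

/-- **`d₁(∇c)` at `(τ, σ)`**: `Σ_{T ⊆ σ × τ} (Σ_{i ∈ σ} ε(σ,i) m(σ ∖ i, τ, T)) • c.boxEval σ τ T`.
[cite: EilenbergMacLane1953, §5 (Thm. 5.2)] [cite: StacksProject, Tag 0BEC] -/
theorem shuffleComponent_d₁_apply (n a b : ℤ) (c : SysCochain (lexSystem P) n) (τ : Simplex κ b)
    (σ : Simplex ι (a + 1)) :
    (((sysBicomplex P).d a (a + 1)).f b).hom (shuffleComponent P n a b c) τ σ =
      ∑ T ∈ ((σ.1 ×ˢ τ.1).image toLex).powerset,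
        (∑ i ∈ σ.1, sign A σ.1 i * (shuffleCoeff (σ.1.erase i) τ.1 T : A)) • c.boxEval σ.1 τ.1 T := by
  rw [sysBicomplex_d_f_apply, sysCochainMap_apply, cochainSystemD_app_apply, sysD_apply]
  -- each face term
  have key : ∀ i ∈ σ.1, (shuffleComponent P n a b c τ).ext0At (σ.1.erase i) σ.1 =
      ∑ T ∈ ((σ.1 ×ˢ τ.1).image toLex).powerset, (shuffleCoeff (σ.1.erase i) τ.1 T : A) • c.boxEval σ.1 τ.1 T := by
    intro i hi
    by_cases hne : (σ.1.erase i).Nonempty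
    · have hcard : ((σ.1.erase i).card : ℤ) = a + 1 := by
        have h3 := Finset.card_erase_of_mem hi; have h4 := σ.2.2; have h5 := σ.2.1.card_pos; omega
      rw [SysCochain.ext0At_val (M := P.flip.obj τ.1) (shuffleComponent P n a b c τ) ⟨σ.1.erase i, hne, hcard⟩ σ.1
        (Finset.erase_subset i σ.1)]
      change ((P.map (homOfLE (Finset.erase_subset i σ.1))).app τ.1).hom
        (shuffleComponent P n a b c τ ⟨σ.1.erase i, hne, hcard⟩) = _
      rw [shuffleComponent_apply, map_sum]
      refine Finset.sum_subset_zero_on_sdiff (Finset.powerset_mono.mpr (Finset.image_subset_image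
        (Finset.product_subset_product (Finset.erase_subset i σ.1) subset_rfl))) (fun T hT' => ?_) fun T hT => ?_
      · rw [shuffleCoeff_eq_zero_of_not_mem_powerset (Finset.mem_sdiff.mp hT').2, Int.cast_zero, zero_smul]
      · rw [map_smul, SysCochain.map_app_boxEval c _ _ (subset_image_toLex_iff.mp (Finset.mem_powerset.mp hT))]
    · -- `σ ∖ i = ∅`: both sides vanish
      unfold SysCochain.ext0At
      rw [dif_neg (fun h => hne h.1.1)]
      symm
      refine Finset.sum_eq_zero fun T _ => ?_
      rw [shuffleCoeff_of_not_nonempty_left hne, Int.cast_zero, zero_smul]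
  rw [Finset.sum_congr rfl fun i hi => by rw [key i hi, Finset.smul_sum]]
  rw [Finset.sum_comm]
  refine Finset.sum_congr rfl fun T _ => ?_
  rw [Finset.sum_smul]
  refine Finset.sum_congr rfl fun i _ => ?_
  rw [smul_smul]

/-- **`d₂(∇c)` at `(τ, σ)`**: `Σ_{T ⊆ σ × τ} (Σ_{j ∈ τ} ε(τ,j) m(σ, τ ∖ j, T)) • c.boxEval σ τ T`.
[cite: EilenbergMacLane1953, §5 (Thm. 5.2)] [cite: StacksProject, Tag 0BEC] -/
theorem shuffleComponent_d₂_apply (n a b : ℤ) (c : SysCochain (lexSystem P) n) (τ : Simplex κ (b + 1))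
    (σ : Simplex ι a) :
    (((sysBicomplex P).X a).d b (b + 1)).hom (shuffleComponent P n a b c) τ σ =
      ∑ T ∈ ((σ.1 ×ˢ τ.1).image toLex).powerset,
        (∑ j ∈ τ.1, sign A τ.1 j * (shuffleCoeff σ.1 (τ.1.erase j) T : A)) • c.boxEval σ.1 τ.1 T := by
  rw [sysBicomplex_X_d_apply, sysD_apply, SysCochain.sum_apply]
  have key : ∀ j ∈ τ.1, (sign A τ.1 j • (shuffleComponent P n a b c).ext0At (τ.1.erase j) τ.1) σ =
      ∑ T ∈ ((σ.1 ×ˢ τ.1).image toLex).powerset,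
        (sign A τ.1 j * (shuffleCoeff σ.1 (τ.1.erase j) T : A)) • c.boxEval σ.1 τ.1 T := by
    intro j hj
    rw [SysCochain.smul_apply]
    by_cases hne : (τ.1.erase j).Nonempty
    · have hcard : ((τ.1.erase j).card : ℤ) = b + 1 := by
        have h3 := Finset.card_erase_of_mem hj; have h4 := τ.2.2; have h5 := τ.2.1.card_pos; omega
      rw [SysCochain.ext0At_val (M := cochainSystem P a) (shuffleComponent P n a b c) ⟨τ.1.erase j, hne, hcard⟩ τ.1
        (Finset.erase_subset j τ.1), cochainSystem_map_apply, sysCochainMap_apply]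
      change sign A τ.1 j • ((P.obj σ.1).map (homOfLE (Finset.erase_subset j τ.1))).hom
        (shuffleComponent P n a b c ⟨τ.1.erase j, hne, hcard⟩ σ) = _
      rw [shuffleComponent_apply, map_sum, Finset.smul_sum]
      refine Finset.sum_subset_zero_on_sdiff (Finset.powerset_mono.mpr (Finset.image_subset_image
        (Finset.product_subset_product subset_rfl (Finset.erase_subset j τ.1)))) (fun T hT' => ?_) fun T hT => ?_
      · rw [shuffleCoeff_eq_zero_of_not_mem_powerset (Finset.mem_sdiff.mp hT').2, Int.cast_zero, mul_zero, zero_smul]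
      · rw [map_smul, SysCochain.obj_map_boxEval c _ _ (subset_image_toLex_iff.mp (Finset.mem_powerset.mp hT)), smul_smul]
    · unfold SysCochain.ext0At
      rw [dif_neg (fun h => hne h.1.1)]
      change sign A τ.1 j • (0 : (P.obj σ.1).obj τ.1) = _
      rw [smul_zero]
      symm
      refine Finset.sum_eq_zero fun T _ => ?_
      rw [shuffleCoeff_of_not_nonempty_right σ.1 hne, Int.cast_zero, mul_zero, zero_smul]
  rw [Finset.sum_congr rfl fun j hj => key j hj, Finset.sum_comm]
  refine Finset.sum_congr rfl fun T _ => ?_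
  rw [Finset.sum_smul]

/-! ### §3 The cochain-map property -/

/-- The total sign `(-1)^{a'}` on an `a'`-simplex `σ` is `(-1)^{#σ - 1}`. [cite: StacksProject, Tag 012K] -/
theorem intCast_negOnePow_eq {a' : ℤ} (σ : Simplex ι a') :
    (((a'.negOnePow : ℤˣ) : ℤ) : A) = (-1 : A) ^ (σ.1.card - 1) := by
  have h1 := σ.2.1.card_pos
  have h2 := σ.2.2
  obtain ⟨k, hk⟩ : ∃ k : ℕ, σ.1.card = k + 1 := ⟨σ.1.card - 1, by omega⟩
  have ha : a' = (k : ℤ) := by rw [hk] at h2; push_cast at h2; omega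
  subst ha
  rw [Int.cast_negOnePow_natCast, hk, Nat.add_sub_cancel]

variable (P)

/-- **The shuffle components commute with the differentials** in the form required by `totalLift`:
`d ≫ ∇_{a',b'} = ∇_{a,b'} ≫ d₁ + (-1)^{a'} • ∇_{a',b} ≫ d₂` for `n' = n+1`, `a' = a+1`, `b' = b+1`, `a' + b' = n'` — the coefficient of
`c_R|` on both sides is the two sides of `sum_shuffleCoeff_insert_mul_sign`. [cite: EilenbergMacLane1953, §5 (Thm. 5.2)]
[cite: StacksProject, Tag 0BEC] -/
theorem shuffleComponent_comm (n n' a a' b b' : ℤ) (hn : n + 1 = n') (ha : a + 1 = a') (hb : b + 1 = b')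
    (hab : a' + b' = n') :
    (sysComplex (lexSystem P)).d n n' ≫ ModuleCat.ofHom (shuffleComponent P n' a' b') =
      ModuleCat.ofHom (shuffleComponent P n a b') ≫ ((sysBicomplex P).d a a').f b' +
        ((a'.negOnePow : ℤˣ) : ℤ) • (ModuleCat.ofHom (shuffleComponent P n a' b) ≫ ((sysBicomplex P).X a').d b b') := by
  subst hn ha hb
  rw [sysComplex_d]
  refine ModuleCat.hom_ext (LinearMap.ext fun c => funext fun τ => funext fun σ => ?_)
  change shuffleComponent P (n + 1) (a + 1) (b + 1) (sysD (lexSystem P) n c) τ σ =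
    ((((sysBicomplex P).d a (a + 1)).f (b + 1)).hom (shuffleComponent P n a (b + 1) c) +
      (((a + 1).negOnePow : ℤˣ) : ℤ) • (((sysBicomplex P).X (a + 1)).d b (b + 1)).hom (shuffleComponent P n (a + 1) b c)) τ σ
  rw [← Int.cast_smul_eq_zsmul A]
  change _ = (((sysBicomplex P).d a (a + 1)).f (b + 1)).hom (shuffleComponent P n a (b + 1) c) τ σ +
    ((((a + 1).negOnePow : ℤˣ) : ℤ) : A) • (((sysBicomplex P).X (a + 1)).d b (b + 1)).hom (shuffleComponent P n (a + 1) b c) τ σ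
  rcases lt_or_ge n 0 with hn0 | hn0
  · -- negative degree: `c = 0`
    haveI : IsEmpty (Simplex (ι ×ₗ κ) n) := isEmpty_simplex_of_neg hn0
    obtain rfl : c = 0 := Subsingleton.elim (α := SysCochain (lexSystem P) n) _ _
    simp only [map_zero]
    change (0 : SysCochain (P.flip.obj τ.1) (a + 1)) σ = (0 : SysCochain (P.flip.obj τ.1) (a + 1)) σ +
      _ • (0 : SysCochain (P.flip.obj τ.1) (a + 1)) σ
    rw [Pi.zero_apply, smul_zero, add_zero]
  rw [shuffleComponent_sysD_apply hn0, shuffleComponent_d₁_apply, shuffleComponent_d₂_apply, Finset.smul_sum,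
    ← Finset.sum_add_distrib]
  refine Finset.sum_congr rfl fun R _ => ?_
  rw [smul_smul, ← add_smul]
  by_cases hR : R.Nonempty
  · congr 1
    have key := congrArg (Int.cast : ℤ → A) (sum_shuffleCoeff_insert_mul_sign σ.1 τ.1 hR)
    push_cast at key
    simp only [intCast_sign] at key
    rw [key, intCast_negOnePow_eq σ, Finset.mul_sum]
  · rw [Finset.not_nonempty_iff_eq_empty] at hR
    subst hR
    rw [SysCochain.boxEval_eq_zero c (fun h => Finset.not_nonempty_empty h.1.1), smul_zero, smul_zero]

/-- **The shuffle map `∇ : Č(lexSystem P) ⟶ Tot Č•,•(P)` exists as a morphism of complexes**: the constructor `totalLift` applies to the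
shuffle components (`Č•,•(P)` is first-quadrant, `shuffleComponent_comm`).  Stated as the degreewise identity
`(totalLift …).f n = totalLiftF …` of the resulting morphism, whose well-typedness is the content. [cite: EilenbergMacLane1953, §5 (Thm. 5.2)]
[cite: StacksProject, Tag 0BEC] -/
theorem shuffle_totalLift_f (n : ℤ) :
    (totalLift (sysBicomplex P) (sysComplex (lexSystem P)) (isZero_sysBicomplex_X_X_of_neg_left P)
        (isZero_sysBicomplex_X_X_of_neg_right P) (fun n a b => ModuleCat.ofHom (shuffleComponent P n a b))
        (shuffleComponent_comm P)).f n =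
      totalLiftF (sysBicomplex P) (sysComplex (lexSystem P)) (fun n a b => ModuleCat.ofHom (shuffleComponent P n a b)) n :=
  rfl

end OrderedCech

end Literature.Algebra.Homology

end
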